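import Summits.HodgeConjecture.HodgeConjecture.Theorems.F0P2oLineWeilDictionaryCongruenceChange -- ★ (CC-1) `dictionary_congruenceChange` (+ cone: ★ p836339 `dictionary_transport`, the CM vocabulary)
import Literature.NumberTheory.Automorphic.UnitaryConjClassClosed                              -- ★ `formCongr_mul`, `map_transpose_formCongr`
import HarnessLib

/-!
# Crux `H413` — N3 ROAD (a), row (CC) PART 2: the unitary `k` EXISTS — the (E4) dictionary of `X_v(μ, ε, χ_f)` does not depend on the form congruence, NO side hypothesis

F0∕P2, cell `hodgecm-mathlib`, crux item `stmt-HodgeConjecture-24833`; A-p01 (g19) on the K1∕N3 lead B-p18 (g29)'s dealing 2026-08-31T22:45:27Z (2) ∕ 23:22:18Z («(CC-2) as ED. 2»;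
sibling file instead, same reason as (FX) PART 2).  PROOF lane (theorems only; no `def`, no instance, no notation, no `sorry`); `--supports stmt-HodgeConjecture-24833 --as helper`.
HONEST LABEL: HC_CM is proved only modulo the printed citations until rung 0 closes; this file proves NO letter — it is plumbing for the (a)-side assembler of N3 #96.

THE POINT.  ★ (CC-1) `dictionary_congruenceChange` transports the (E4) dictionary from the chart `ch_{T₀}` to the chart `ch_T` GIVEN a unitary `k ∈ U(Φ₃)(L⁺_v)` with
`T·u·T⁻¹ = T₀·(k u k⁻¹)·T₀⁻¹`.  Here that `k` is CONSTRUCTED for any two congruences of the same `diag dV` (odd rank `3`): `g := T₀⁻¹T` is a `Φ₃`-similitude,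
`σ(g)ᵀ Φ₃ g = ν·Φ₃` with `ν = a₀⁻¹a ∈ L⁺_v`; `N(det g) = ν³`; `λ := det g · ν⁻¹` has `N(λ) = ν`; `k := λ⁻¹g` is unitary and conjugates like `g` (scalars are central).  HEAD:
**`dictionary_congruenceChange_of_formCongr`** — (CC-1) with `hk` discharged: for ANY two congruences `(T₀, a₀, h₀)`, `(T, a, h)` of `diag dV`, every (E4)-shaped dictionary
`(π, σ, Tr, η)` for `ch_{T₀}` yields one for `ch_T` with the SAME `σ`, the SAME `η`.  With ★ `dictionary_frameTransport_ofRecord` ((FX) PART 2) this makes the (E4)∕(E5)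
data independent of BOTH choices the N3 letter quantifies over (the rational frame `dV ↦ Pᵀ dV P` and the local congruence `T`).

References: [Rogawski1990] §1.9 p. 8 (`GU(n)` in odd rank), §14.2 p. 232; [PlatonovRapinchuk1994] §2.3; [GelbartRogawski1991] §3.2 p. 457; [MoeglinVignerasWaldspurger1987] Chap. 2 II Remarque (3).
-/

set_option autoImplicit false
-- the mandated namespace repeats `HodgeConjecture.HodgeConjecture`, as in every `Theorems/*.lean` of this sub-problem
set_option linter.dupNamespace false

noncomputable section

open NumberField IsDedekindDomain Matrix MeasureTheory
open scoped MatrixGroups Kronecker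
open Literature.NumberTheory.Automorphic Literature.NumberTheory.Automorphic.UnitaryGroup
open Literature.NumberTheory.GelbartRogawski1991 Literature.NumberTheory.GelbartRogawski1991.UnitaryDualPair
open Literature.NumberTheory.GelbartRogawski1991.UnitaryDualPair.LocalSplitting Literature.NumberTheory.GelbartRogawski1991.UnitaryDualPair.WeilCoinv
open Literature.NumberTheory.GelbartRogawski1991.GRConstruction
open Literature.NumberTheory.Automorphic.IdeleClassGroup
open Literature.NumberTheory.Automorphic.Liu2021 Literature.NumberTheory.Automorphic.Liu2021.Def411WeilCarriers
open Literature.NumberTheory.Automorphic.Liu2021.Def411WeilCarriersDoubling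
open Literature.RepresentationTheory Literature.RepresentationTheory.HeisenbergGroup Literature.RepresentationTheory.Liu2021
open Literature.NumberTheory.GaloisRepresentations Literature.RepresentationTheory.HarrisKudlaSweet1996
open Literature.NumberTheory.Rogawski1990

namespace Summit.HodgeConjecture.HodgeConjecture.Cruxes.H413.F0P2oLineWeilDictionaryCongruenceChangeExists

open Summit.HodgeConjecture.HodgeConjecture.Cruxes.H413.F0P2oLineWeilDictionaryFrameTransport
open Summit.HodgeConjecture.HodgeConjecture.Cruxes.H413.F0P2oLineWeilDictionaryCongruenceChange

variable (L : Type) [Field L] [NumberField L] [IsCMField L] (v : HeightOneSpectrum (𝓞 ↥(maximalRealSubfield L)))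
  (dV : Fin 3 → L) (hdV : ∀ i, IsCMField.complexConj L (dV i) = dV i)
  (T₀ : GL (Fin 3) (LocalRing L v)) {a₀ : LocalRing L v} (ha₀ : IsUnit a₀)
  (h₀ : formCongr (conjLocal L (IsCMField.complexConj L) v) T₀ ((Matrix.diagonal dV).map (algebraMap L (LocalRing L v))) =
    a₀ • (Matrix.of fun i j : Fin 3 => if i.val + j.val + 1 = 3 then (1 : L) else 0).map (algebraMap L (LocalRing L v)))
  (T : GL (Fin 3) (LocalRing L v)) {a : LocalRing L v} (ha : IsUnit a)
  (h : formCongr (conjLocal L (IsCMField.complexConj L) v) T ((Matrix.diagonal dV).map (algebraMap L (LocalRing L v))) =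
    a • (Matrix.of fun i j : Fin 3 => if i.val + j.val + 1 = 3 then (1 : L) else 0).map (algebraMap L (LocalRing L v)))

/-! ## §1 Realness of the congruence scalar; scalar units are central -/

include hdV in
/-- `diag(dV)_v` is hermitian for `c ⊗ 1` (a real diagonal). [cite: Rogawski1990, §1.9 p. 8] -/
theorem map_transpose_diagonal_real :
    (((Matrix.diagonal dV).map (algebraMap L (LocalRing L v))).map (conjLocal L (IsCMField.complexConj L) v))ᵀ =
      (Matrix.diagonal dV).map (algebraMap L (LocalRing L v)) := by
  rw [Matrix.diagonal_map (map_zero _), Matrix.diagonal_map (map_zero _), Matrix.diagonal_transpose]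
  congr 1
  funext i
  show conjLocal L (IsCMField.complexConj L) v (algebraMap L (LocalRing L v) (dV i)) = algebraMap L (LocalRing L v) (dV i)
  rw [conjLocal_algebraMap, hdV]

/-- `Φ₃,v` is hermitian for `c ⊗ 1` (entries `0, 1`, symmetric). [cite: Rogawski1990, §1.9 p. 8] -/
theorem map_transpose_antidiag :
    (((Matrix.of fun i j : Fin 3 => if i.val + j.val + 1 = 3 then (1 : L) else 0).map (algebraMap L (LocalRing L v))).map
        (conjLocal L (IsCMField.complexConj L) v))ᵀ =
      (Matrix.of fun i j : Fin 3 => if i.val + j.val + 1 = 3 then (1 : L) else 0).map (algebraMap L (LocalRing L v)) := by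
  refine Matrix.ext fun i j => ?_
  simp only [Matrix.transpose_apply, Matrix.map_apply, Matrix.of_apply]
  by_cases hij : i.val + j.val + 1 = 3
  · have hji : j.val + i.val + 1 = 3 := by omega
    rw [if_pos hji, if_pos hij, conjLocal_algebraMap, map_one]
  · have hji : ¬ (j.val + i.val + 1 = 3) := by omega
    rw [if_neg hji, if_neg hij, conjLocal_algebraMap, map_zero]

include hdV h in
/-- **the scalar of a form congruence `ᵗT̄ · diag(dV)_v · T = a · Φ₃` is `c ⊗ 1`-fixed** (`a ∈ L⁺_v`): both forms are hermitian (★ `map_transpose_formCongr`). [cite: Rogawski1990, §1.9 p. 8] [cite: PlatonovRapinchuk1994, §2.3] -/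
theorem conjLocal_scalar_eq : conjLocal L (IsCMField.complexConj L) v a = a := by
  have hh := map_transpose_formCongr (conjLocal L (IsCMField.complexConj L) v) _ (map_transpose_diagonal_real L v dV hdV)
    (conjLocal_conjLocal_cm L v) T
  rw [h, Matrix.map_smul', Matrix.transpose_smul, map_transpose_antidiag] at hh
  have h02 := congrFun (congrFun hh 0) 2
  simp only [Matrix.smul_apply, Matrix.map_apply, Matrix.of_apply, smul_eq_mul] at h02
  simpa using h02
  exact fun x y => map_mul _ x y


/-! ## §2 (CC-2) the unitary `k` -/

/-- a scalar unit of `GL_n` is central (Mathlib `Matrix.scalar_commute`). [cite: PlatonovRapinchuk1994, §2.3] -/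
theorem scalarGL_comm {R : Type*} [CommRing R] {n : Type*} [Fintype n] [DecidableEq n] (r : Rˣ) (x : GL n R) :
    Units.map (Matrix.scalar n).toMonoidHom r * x = x * Units.map (Matrix.scalar n).toMonoidHom r := by
  refine Units.ext ?_
  change Matrix.scalar n (r : R) * (x : Matrix n n R) = (x : Matrix n n R) * Matrix.scalar n (r : R)
  exact (Matrix.scalar_commute (r : R) (fun r' => Commute.all _ r') (x : Matrix n n R)).eq

/-- a ring endomorphism fixes the inverse of a unit it fixes. [cite: PlatonovRapinchuk1994, §2.3] -/
theorem map_units_inv_of_eq {R : Type*} [CommRing R] (σ : R →+* R) (u : Rˣ) (hu : σ (u : R) = u) : σ ((u⁻¹ : Rˣ) : R) = ((u⁻¹ : Rˣ) : R) := by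
  have h1 : σ ((u⁻¹ : Rˣ) : R) * (u : R) = 1 := by
    rw [← hu, ← map_mul, Units.inv_mul, map_one]
  calc σ ((u⁻¹ : Rˣ) : R) = σ ((u⁻¹ : Rˣ) : R) * ((u : R) * ((u⁻¹ : Rˣ) : R)) := by rw [Units.mul_inv, mul_one]
    _ = ((u⁻¹ : Rˣ) : R) := by rw [← mul_assoc, h1, one_mul]

include hdV h₀ h in
set_option synthInstance.maxHeartbeats 400000 in
set_option maxHeartbeats 1600000 in
/-- **(CC-2) EXISTENCE OF THE UNITARY `k`** — two form congruences `(T₀, a₀)`, `(T, a)` of the same `diag dV` onto `Φ₃` differ by `λ·k` with `λ` a SCALAR and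
`k ∈ U(Φ₃)(L⁺_v)` UNITARY, so that `T·u·T⁻¹ = T₀·(k u k⁻¹)·T₀⁻¹` for every `u ∈ U(Φ₃)(L⁺_v)` (the hypothesis `hk` of ★ `dictionary_congruenceChange`).  ODD RANK:
`g := T₀⁻¹T` is a `Φ₃`-similitude with factor `ν = a₀⁻¹a` (`ν ∈ L⁺_v` by `conjLocal_scalar_eq`); determinants give `N(det g) = ν³`, so `λ := det g · ν⁻¹` has `N(λ) = ν` and
`k := λ⁻¹ g` is unitary; scalars are central (`scalarGL_comm`).  [`GU(Φ₃) = E^× · U(Φ₃)` in odd rank.] [cite: Rogawski1990, §1.9 p. 8; §14.2 p. 232] [cite: PlatonovRapinchuk1994, §2.3] -/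
theorem exists_unitary_conj_of_formCongr :
    ∃ k : Gqs L v, ∀ u : Gqs L v,
      ((cmDatumLocalCongr L v T ha h u).val : GL (Fin 3) (LocalRing L v)) = (cmDatumLocalCongr L v T₀ ha₀ h₀ (k * u * k⁻¹)).val := by
  have hσσ := conjLocal_conjLocal_cm L v
  have hσa : conjLocal L (IsCMField.complexConj L) v a = a := conjLocal_scalar_eq L v dV hdV T h
  have hσa₀ : conjLocal L (IsCMField.complexConj L) v a₀ = a₀ := conjLocal_scalar_eq L v dV hdV T₀ h₀
  -- the similitude `g := T₀⁻¹ T`: `σ(g)ᵀ Φ g = ν • Φ`, `ν = a₀⁻¹ a`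
  set g : GL (Fin 3) (LocalRing L v) := T₀⁻¹ * T with hgdef
  set ν : (LocalRing L v)ˣ := ha₀.unit⁻¹ * ha.unit with hνdef
  have hνval : (ν : LocalRing L v) = ((ha₀.unit⁻¹ : (LocalRing L v)ˣ) : LocalRing L v) * a := by
    rw [hνdef, Units.val_mul, IsUnit.unit_spec]
  have hσν : conjLocal L (IsCMField.complexConj L) v (ν : LocalRing L v) = ν := by
    rw [hνval, map_mul, hσa, map_units_inv_of_eq _ _ (by rw [IsUnit.unit_spec]; exact hσa₀)]
  have hgΦ : formCongr (conjLocal L (IsCMField.complexConj L) v) g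
      ((Matrix.of fun i j : Fin 3 => if i.val + j.val + 1 = 3 then (1 : L) else 0).map (algebraMap L (LocalRing L v))) =
      (ν : LocalRing L v) • (Matrix.of fun i j : Fin 3 => if i.val + j.val + 1 = 3 then (1 : L) else 0).map (algebraMap L (LocalRing L v)) := by
    have h1 : formCongr (conjLocal L (IsCMField.complexConj L) v) g (a₀ • (Matrix.of fun i j : Fin 3 => if i.val + j.val + 1 = 3 then (1 : L) else 0).map
        (algebraMap L (LocalRing L v))) = a • (Matrix.of fun i j : Fin 3 => if i.val + j.val + 1 = 3 then (1 : L) else 0).map (algebraMap L (LocalRing L v)) := by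
      rw [← h₀, hgdef, formCongr_mul, formCongr_inv_formCongr, h]
    have h2 : formCongr (conjLocal L (IsCMField.complexConj L) v) g (a₀ • (Matrix.of fun i j : Fin 3 => if i.val + j.val + 1 = 3 then (1 : L) else 0).map
        (algebraMap L (LocalRing L v))) = a₀ • formCongr (conjLocal L (IsCMField.complexConj L) v) g
        ((Matrix.of fun i j : Fin 3 => if i.val + j.val + 1 = 3 then (1 : L) else 0).map (algebraMap L (LocalRing L v))) := by
      show ((Units.val g).map (conjLocal L (IsCMField.complexConj L) v))ᵀ *
          (a₀ • (Matrix.of fun i j : Fin 3 => if i.val + j.val + 1 = 3 then (1 : L) else 0).map (algebraMap L (LocalRing L v))) * g = _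
      rw [Matrix.mul_smul, Matrix.smul_mul]
    rw [h2] at h1
    have h3 := congrArg (fun M => ((ha₀.unit⁻¹ : (LocalRing L v)ˣ) : LocalRing L v) • M) h1
    simp only [smul_smul, IsUnit.val_inv_mul, one_smul] at h3
    rw [← hνval] at h3
    exact h3
  -- determinants: `σ(det g) · det g = ν³`
  have hΦdet : IsUnit ((Matrix.of fun i j : Fin 3 => if i.val + j.val + 1 = 3 then (1 : L) else 0).map (algebraMap L (LocalRing L v))).det := by
    rw [← RingHom.mapMatrix_apply, ← RingHom.map_det]
    exact (isUnit_antidiagOne_det L 3).map _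
  have hdet : conjLocal L (IsCMField.complexConj L) v (Units.val g).det * (Units.val g).det =
      (ν : LocalRing L v) ^ 3 := by
    have hd := congrArg Matrix.det hgΦ
    rw [show formCongr (conjLocal L (IsCMField.complexConj L) v) g
        ((Matrix.of fun i j : Fin 3 => if i.val + j.val + 1 = 3 then (1 : L) else 0).map (algebraMap L (LocalRing L v))) =
        ((Units.val g).map (conjLocal L (IsCMField.complexConj L) v))ᵀ *
          (Matrix.of fun i j : Fin 3 => if i.val + j.val + 1 = 3 then (1 : L) else 0).map (algebraMap L (LocalRing L v)) * g from rfl,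
      Matrix.det_mul, Matrix.det_mul, Matrix.det_transpose, ← RingHom.mapMatrix_apply, ← RingHom.map_det, Matrix.det_smul, Fintype.card_fin] at hd
    -- `σ(det g) * det Φ * det g = ν³ * det Φ`
    have hd' : (conjLocal L (IsCMField.complexConj L) v (Units.val g).det * (Units.val g).det) *
        ((Matrix.of fun i j : Fin 3 => if i.val + j.val + 1 = 3 then (1 : L) else 0).map (algebraMap L (LocalRing L v))).det =
        (ν : LocalRing L v) ^ 3 * ((Matrix.of fun i j : Fin 3 => if i.val + j.val + 1 = 3 then (1 : L) else 0).map (algebraMap L (LocalRing L v))).det := by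
      rw [← hd]; ring
    exact hΦdet.mul_right_cancel hd'
  -- `λ := det g · ν⁻¹`, `σ(λ) λ = ν`
  set lam : (LocalRing L v)ˣ := Matrix.GeneralLinearGroup.det g * ν⁻¹ with hlamdef
  have hlam : conjLocal L (IsCMField.complexConj L) v (lam : LocalRing L v) * (lam : LocalRing L v) = ν := by
    have hσνi := map_units_inv_of_eq (conjLocal L (IsCMField.complexConj L) v) ν hσν
    rw [hlamdef, Units.val_mul, map_mul, Matrix.GeneralLinearGroup.val_det_apply, hσνi]
    calc conjLocal L (IsCMField.complexConj L) v (Units.val g).det * ((ν⁻¹ : (LocalRing L v)ˣ) : LocalRing L v) *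
          ((Units.val g).det * ((ν⁻¹ : (LocalRing L v)ˣ) : LocalRing L v))
        = (conjLocal L (IsCMField.complexConj L) v (Units.val g).det * (Units.val g).det) *
            (((ν⁻¹ : (LocalRing L v)ˣ) : LocalRing L v) * ((ν⁻¹ : (LocalRing L v)ˣ) : LocalRing L v)) := by ring
      _ = (ν : LocalRing L v) ^ 3 * (((ν⁻¹ : (LocalRing L v)ˣ) : LocalRing L v) * ((ν⁻¹ : (LocalRing L v)ˣ) : LocalRing L v)) := by rw [hdet]
      _ = ν := by rw [← Units.val_pow_eq_pow_val, ← Units.val_mul, ← Units.val_mul]; congr 1; group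
  -- `k₀ := λ⁻¹ g`
  set s : GL (Fin 3) (LocalRing L v) := Units.map (Matrix.scalar (Fin 3)).toMonoidHom lam with hsdef
  set k₀ : GL (Fin 3) (LocalRing L v) := s⁻¹ * g with hk₀def
  have hk₀val : (k₀.1 : Matrix (Fin 3) (Fin 3) (LocalRing L v)) = ((lam⁻¹ : (LocalRing L v)ˣ) : LocalRing L v) • (Units.val g) := by
    rw [hk₀def, Units.val_mul, hsdef, ← map_inv, Units.coe_map, RingHom.toMonoidHom_eq_coe, MonoidHom.coe_coe, Matrix.scalar_apply,
      ← Matrix.smul_eq_diagonal_mul]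
  -- `σ(λ⁻¹)·λ⁻¹·ν = 1`
  have hunit : conjLocal L (IsCMField.complexConj L) v ((lam⁻¹ : (LocalRing L v)ˣ) : LocalRing L v) * ((lam⁻¹ : (LocalRing L v)ˣ) : LocalRing L v) *
      (ν : LocalRing L v) = 1 := by
    rw [← hlam]
    calc conjLocal L (IsCMField.complexConj L) v ((lam⁻¹ : (LocalRing L v)ˣ) : LocalRing L v) * ((lam⁻¹ : (LocalRing L v)ˣ) : LocalRing L v) *
          (conjLocal L (IsCMField.complexConj L) v (lam : LocalRing L v) * (lam : LocalRing L v))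
        = conjLocal L (IsCMField.complexConj L) v (((lam⁻¹ : (LocalRing L v)ˣ) : LocalRing L v) * (lam : LocalRing L v)) *
            (((lam⁻¹ : (LocalRing L v)ˣ) : LocalRing L v) * (lam : LocalRing L v)) := by rw [map_mul]; ring
      _ = 1 := by rw [Units.inv_mul, map_one, one_mul]
  -- membership `k₀ ∈ U(Φ₃)(L⁺_v)`
  have hmem : k₀ ∈ «local» L (IsCMField.complexConj L) 3 (qsForm L) v := by
    rw [local_eq_unitaryGroupOfForm_map, mem_unitaryGroupOfForm_iff, hk₀val]
    have hsm : ((((lam⁻¹ : (LocalRing L v)ˣ) : LocalRing L v) • (Units.val g)).map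
        (conjLocal L (IsCMField.complexConj L) v)) =
        conjLocal L (IsCMField.complexConj L) v ((lam⁻¹ : (LocalRing L v)ˣ) : LocalRing L v) •
          (Units.val g).map (conjLocal L (IsCMField.complexConj L) v) := by
      refine Matrix.ext fun i j => ?_
      simp only [Matrix.map_apply, Matrix.smul_apply, smul_eq_mul, map_mul]
    show ((((lam⁻¹ : (LocalRing L v)ˣ) : LocalRing L v) • (Units.val g)).map (conjLocal L (IsCMField.complexConj L) v))ᵀ *
        (Matrix.of fun i j : Fin 3 => if i.val + j.val + 1 = 3 then (1 : L) else 0).map (algebraMap L (LocalRing L v)) *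
        (((lam⁻¹ : (LocalRing L v)ˣ) : LocalRing L v) • (Units.val g)) =
      (Matrix.of fun i j : Fin 3 => if i.val + j.val + 1 = 3 then (1 : L) else 0).map (algebraMap L (LocalRing L v))
    rw [hsm, Matrix.transpose_smul, Matrix.smul_mul, Matrix.smul_mul, Matrix.mul_smul, smul_smul,
      show ((Units.val g).map (conjLocal L (IsCMField.complexConj L) v))ᵀ *
          (Matrix.of fun i j : Fin 3 => if i.val + j.val + 1 = 3 then (1 : L) else 0).map (algebraMap L (LocalRing L v)) * g =
        formCongr (conjLocal L (IsCMField.complexConj L) v) g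
          ((Matrix.of fun i j : Fin 3 => if i.val + j.val + 1 = 3 then (1 : L) else 0).map (algebraMap L (LocalRing L v))) from rfl,
      hgΦ, smul_smul, hunit, one_smul]
  -- the witness and `hk`
  refine ⟨⟨k₀, hmem⟩, fun u => ?_⟩
  rw [coe_cmDatumLocalCongr_apply, coe_cmDatumLocalCongr_apply]
  have hcent : ∀ y : GL (Fin 3) (LocalRing L v), s⁻¹ * y * s = y := fun y => by
    rw [mul_assoc, ← scalarGL_comm lam y, ← hsdef, ← mul_assoc, inv_mul_cancel, one_mul]
  have hconj : k₀ * (u.val : GL (Fin 3) (LocalRing L v)) * k₀⁻¹ = g * u.val * g⁻¹ := by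
    calc k₀ * (u.val : GL (Fin 3) (LocalRing L v)) * k₀⁻¹ = s⁻¹ * (g * u.val * g⁻¹) * s := by rw [hk₀def]; group
      _ = g * u.val * g⁻¹ := hcent _
  change (T * u.val * T⁻¹ : GL (Fin 3) (LocalRing L v)) = T₀ * (k₀ * u.val * k₀⁻¹) * T₀⁻¹
  rw [hconj, hgdef]
  group

/-! ## §3 HEAD: (CC) with `hk` discharged -/

include hdV h₀ h in
set_option synthInstance.maxHeartbeats 400000 in
set_option maxHeartbeats 4000000 in
/-- **THE (E4) DICTIONARY OF `X_v(μ, ε, χ_f)` DOES NOT DEPEND ON THE FORM CONGRUENCE — NO SIDE HYPOTHESIS** (★ `dictionary_congruenceChange` at the `k` of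
`exists_unitary_conj_of_formCongr`): for ANY two congruences `(T₀, a₀, h₀)`, `(T, a, h)` of the same `diag dV` onto `Φ₃` and ANY local splitting package `𝓢` of the pair
`U(diag dV ⊗ (ε))`, every (E4)-shaped dictionary `(π, σ, Tr, η)` for the chart `ch_{T₀}` yields one for `ch_T` with the SAME `σ` and the SAME `η`.
[cite: GelbartRogawski1991, §3.2 (3.2.1)–(3.2.2) p. 457] [cite: Rogawski1990, §1.9 p. 8; §14.2 p. 232] [cite: MoeglinVignerasWaldspurger1987, Chap. 2 II Remarque (3)] -/
theorem dictionary_congruenceChange_of_formCongr (hdV0 : ∀ i, dV i ≠ 0) {n' : ℕ} (e₁ : Fin 3 × Fin 1 ≃ Fin n') (ε : (↥(maximalRealSubfield L))ˣ)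
    (𝓢 : FinLocalSplittings (↥(maximalRealSubfield L)) L (IsCMField.complexConj L) n' (complexConj_imagUnit L) (imagUnit_ne_zero L)
      (imagUnit_mul_self L) (UnitaryDualPair.gram (↥(maximalRealSubfield L)) e₁ (realDiagonal L dV hdV) (TW (↥(maximalRealSubfield L)) ε))
      (isSymm_gram (↥(maximalRealSubfield L)) e₁ (realDiagonal_isSymm L dV hdV) (isSymm_TW (↥(maximalRealSubfield L)) ε))
      (J := Matrix.reindex e₁ e₁ (Matrix.diagonal dV ⊗ₖ JW (↥(maximalRealSubfield L)) L ε))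
      (reindex_kronecker_eq_gram_map (↥(maximalRealSubfield L)) L e₁ (realDiagonal_map L dV hdV).symm (JW_eq (↥(maximalRealSubfield L)) L ε)))
    (N : Subgroup (Gqs L v)) {n₀ : ℕ} (e₀ : Fin 1 × Fin 1 ≃ Fin n₀)
    (μ : Literature.NumberTheory.Automorphic.IdeleClassGroup L →ₜ* Circle) (hμ : IsConjugateSymplectic L μ)
    {M : Type} [AddCommGroup M] [Module ℂ M] (η : localPi L (IsCMField.complexConj L) 1 (JW (↥(maximalRealSubfield L)) L ε) v →* ℂˣ)
    (hdict : ∃ (π : SchwartzBruhat (Fin n' → v.adicCompletion (↥(maximalRealSubfield L))) →ₗ[ℂ] M)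
        (σ : Representation ℂ (localPi L (IsCMField.complexConj L) 1 (JW (↥(maximalRealSubfield L)) L ε) v) M)
        (Tr : M ≃ₗ[ℂ] SchwartzBruhat (Fin n₀ → v.adicCompletion (↥(maximalRealSubfield L)))),
      Function.Surjective π ∧
      LinearMap.ker π = Representation.Coinvariants.ker
        ((((MpPsi.toRep (localSchrodinger (↥(maximalRealSubfield L)) n' (UnitaryDualPair.gram (↥(maximalRealSubfield L)) e₁ (realDiagonal L dV hdV) (TW (↥(maximalRealSubfield L)) ε)) v)).comp (𝓢.s v)).comp
          ((localLineInl L (IsCMField.complexConj L) 3 e₁ (Matrix.diagonal dV) (JW (↥(maximalRealSubfield L)) L ε) v).comp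
            ((localPiEquiv L (IsCMField.complexConj L) 3 (Matrix.diagonal dV) v).symm.toMonoidHom.comp (cmDatumLocalCongr L v T₀ ha₀ h₀).toMonoidHom))).comp N.subtype) ∧
      (∀ (u : localPi L (IsCMField.complexConj L) 1 (JW (↥(maximalRealSubfield L)) L ε) v) (f : SchwartzBruhat (Fin n' → v.adicCompletion (↥(maximalRealSubfield L)))),
        π (MpPsi.toRep (localSchrodinger (↥(maximalRealSubfield L)) n' (UnitaryDualPair.gram (↥(maximalRealSubfield L)) e₁ (realDiagonal L dV hdV) (TW (↥(maximalRealSubfield L)) ε)) v)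
          (𝓢.s v (localCenter L (IsCMField.complexConj L) n' (Matrix.reindex e₁ e₁ (Matrix.diagonal dV ⊗ₖ JW (↥(maximalRealSubfield L)) L ε)) (JW (↥(maximalRealSubfield L)) L ε) (JW_apply_ne_zero (↥(maximalRealSubfield L)) L ε) v u)) f) = σ u (π f)) ∧
      ∀ (u : localPi L (IsCMField.complexConj L) 1 (JW (↥(maximalRealSubfield L)) L ε) v) (m : M),
        lineWeilCM L e₀ (kernelLineCM dV) (complexConj_kernelLineCM dV hdV) (kernelLineCM_ne_zero dV hdV0) μ hμ ε v u (Tr m) = ((η u : ℂˣ) : ℂ) • Tr (σ u m)) :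
    ∃ (π' : SchwartzBruhat (Fin n' → v.adicCompletion (↥(maximalRealSubfield L))) →ₗ[ℂ] M)
        (σ : Representation ℂ (localPi L (IsCMField.complexConj L) 1 (JW (↥(maximalRealSubfield L)) L ε) v) M)
        (Tr' : M ≃ₗ[ℂ] SchwartzBruhat (Fin n₀ → v.adicCompletion (↥(maximalRealSubfield L)))),
      Function.Surjective π' ∧
      LinearMap.ker π' = Representation.Coinvariants.ker
        ((((MpPsi.toRep (localSchrodinger (↥(maximalRealSubfield L)) n' (UnitaryDualPair.gram (↥(maximalRealSubfield L)) e₁ (realDiagonal L dV hdV) (TW (↥(maximalRealSubfield L)) ε)) v)).comp (𝓢.s v)).comp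
          ((localLineInl L (IsCMField.complexConj L) 3 e₁ (Matrix.diagonal dV) (JW (↥(maximalRealSubfield L)) L ε) v).comp
            ((localPiEquiv L (IsCMField.complexConj L) 3 (Matrix.diagonal dV) v).symm.toMonoidHom.comp (cmDatumLocalCongr L v T ha h).toMonoidHom))).comp N.subtype) ∧
      (∀ (u : localPi L (IsCMField.complexConj L) 1 (JW (↥(maximalRealSubfield L)) L ε) v) (f : SchwartzBruhat (Fin n' → v.adicCompletion (↥(maximalRealSubfield L)))),
        π' (MpPsi.toRep (localSchrodinger (↥(maximalRealSubfield L)) n' (UnitaryDualPair.gram (↥(maximalRealSubfield L)) e₁ (realDiagonal L dV hdV) (TW (↥(maximalRealSubfield L)) ε)) v)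
          (𝓢.s v (localCenter L (IsCMField.complexConj L) n' (Matrix.reindex e₁ e₁ (Matrix.diagonal dV ⊗ₖ JW (↥(maximalRealSubfield L)) L ε)) (JW (↥(maximalRealSubfield L)) L ε) (JW_apply_ne_zero (↥(maximalRealSubfield L)) L ε) v u)) f) = σ u (π' f)) ∧
      ∀ (u : localPi L (IsCMField.complexConj L) 1 (JW (↥(maximalRealSubfield L)) L ε) v) (m : M),
        lineWeilCM L e₀ (kernelLineCM dV) (complexConj_kernelLineCM dV hdV) (kernelLineCM_ne_zero dV hdV0) μ hμ ε v u (Tr' m) = ((η u : ℂˣ) : ℂ) • Tr' (σ u m) := by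
  obtain ⟨k, hk⟩ := exists_unitary_conj_of_formCongr L v dV hdV T₀ ha₀ h₀ T ha h
  exact dictionary_congruenceChange L v dV hdV hdV0 e₁ ε 𝓢 T₀ ha₀ h₀ T ha h k hk N e₀ μ hμ η hdict

end Summit.HodgeConjecture.HodgeConjecture.Cruxes.H413.F0P2oLineWeilDictionaryCongruenceChangeExists

end
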